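import Mathlib.MeasureTheory.Integral.Bochner.Set
import Mathlib.Probability.Notation
import HarnessLib

/-!
# Transplant sharpness LIV — the Chung–Erdős (second-moment) inequality for a finite family of events

builds on p205010 (kernel theorem, internal audit signed; external expert review pending).
Status sentence (coordinator 2026-08-20T04:30Z): "θ(p_c) = 0 on ℤ^d, all d ≥ 2 — kernel-verified (Lean 4/Mathlib,
standard axioms); internal adversarial audit SIGNED 2026-08-20 04:29Z; external expert review pending."

Lane `prim-bschramm`, seat p5 (sharpness); memo `run/shared/lean/prim/bschramm/P5-SHARPNESS.md` §48 (row 85, kernel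
programme "RAY"; plan `run/shared/lean/prim/bschramm/prim-bschramm-p5-g22/RAY-PLAN.md` §4 item L2).

For a finite measure `μ` and finitely many measurable events `E i`, `i ∈ s`:

  `(Σ_{i∈s} μ(E i))² ≤ μ(⋃_{i∈s} E i) · Σ_{i∈s} Σ_{j∈s} μ(E i ∩ E j)`

(K. L. Chung, P. Erdős, *On the application of the Borel–Cantelli lemma*, Trans. AMS 72 (1952), (4); the finite form of the
Paley–Zygmund / second-moment method for the counting variable `N = Σ 1_{E i}`). Proof: for every real `t` the integral of
`(N - t·1_U)²` is non-negative and equals `S₂ - 2 t S₁ + t² μ(U)` (pointwise expansion: `N` vanishes off `U = ⋃ E i`);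
take `t = S₁ / μ(U)`.

This is the matching step of the RAY programme (the count of ray positions where an upper arm, a lower arm and an open
bridge coincide); it is stated for an arbitrary finite measure so that both the decorated-graph law and an inhomogeneous
product law can use it.
-/

noncomputable section

namespace Summit.CriticalPhenomena.PercolationContinuityZ3.Theorems.TransplantSharpness

namespace Ray

open MeasureTheory Set Finset

variable {Ω : Type*} [MeasurableSpace Ω] {ι : Type*}

omit [MeasurableSpace Ω] in
/-- Pointwise expansion of `(N - t 1_U)²` for the counting function `N = Σ_{i∈s} 1_{E i}` and `U ⊇ ⋃ E i`:
`(N ω - t 1_U ω)² = Σ_{i,j} 1_{E i ∩ E j}(ω) - 2 t Σ_i 1_{E i}(ω) + t² 1_U(ω)`. [folklore] -/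
theorem countSq_expand (s : Finset ι) (E : ι → Set Ω) (U : Set Ω) (hU : ∀ i ∈ s, E i ⊆ U) (t : ℝ) (ω : Ω) :
    (∑ i ∈ s, (E i).indicator (1 : Ω → ℝ) ω - t * U.indicator 1 ω) ^ 2 =
      ∑ i ∈ s, ∑ j ∈ s, (E i ∩ E j).indicator (1 : Ω → ℝ) ω
        - 2 * t * ∑ i ∈ s, (E i).indicator (1 : Ω → ℝ) ω + t ^ 2 * U.indicator 1 ω := by
  classical
  by_cases hω : ω ∈ U
  · have hb : U.indicator (1 : Ω → ℝ) ω = 1 := by simp [hω]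
    have hsq : (∑ i ∈ s, (E i).indicator (1 : Ω → ℝ) ω) ^ 2 =
        ∑ i ∈ s, ∑ j ∈ s, (E i ∩ E j).indicator (1 : Ω → ℝ) ω := by
      rw [sq, Finset.sum_mul_sum]
      refine Finset.sum_congr rfl fun i _ => Finset.sum_congr rfl fun j _ => ?_
      rw [inter_indicator_one]
      rfl
    rw [hb, ← hsq]
    ring
  · -- off `U` everything vanishes
    have hb : U.indicator (1 : Ω → ℝ) ω = 0 := by simp [hω]
    have ha : ∀ i ∈ s, (E i).indicator (1 : Ω → ℝ) ω = 0 := fun i hi =>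
      indicator_of_notMem (fun h => hω (hU i hi h)) _
    have hab : ∀ i ∈ s, ∀ j ∈ s, (E i ∩ E j).indicator (1 : Ω → ℝ) ω = 0 := fun i hi j _ =>
      indicator_of_notMem (fun h => hω (hU i hi h.1)) _
    rw [hb, Finset.sum_eq_zero ha, Finset.sum_eq_zero fun i hi => Finset.sum_eq_zero (hab i hi)]
    ring

/-- **Chung–Erdős inequality** (Chung–Erdős 1952, (4); the second-moment method for `N = Σ 1_{E i}`): for a finite measure
`μ` and measurable events `E i`, `i ∈ s`,
`(Σ_i μ(E i))² ≤ μ(⋃_i E i) · Σ_i Σ_j μ(E i ∩ E j)`. [folklore] -/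
theorem sq_sum_real_le_real_biUnion_mul (μ : Measure Ω) [IsFiniteMeasure μ] (s : Finset ι) (E : ι → Set Ω)
    (hE : ∀ i ∈ s, MeasurableSet (E i)) :
    (∑ i ∈ s, μ.real (E i)) ^ 2 ≤
      μ.real (⋃ i ∈ s, E i) * ∑ i ∈ s, ∑ j ∈ s, μ.real (E i ∩ E j) := by
  classical
  set U : Set Ω := ⋃ i ∈ s, E i with hUdef
  have hUm : MeasurableSet U := Finset.measurableSet_biUnion s hE
  have hsub : ∀ i ∈ s, E i ⊆ U := fun i hi => Set.subset_biUnion_of_mem (u := fun i => E i) hi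
  set S₁ : ℝ := ∑ i ∈ s, μ.real (E i) with hS₁
  set S₂ : ℝ := ∑ i ∈ s, ∑ j ∈ s, μ.real (E i ∩ E j) with hS₂
  set u : ℝ := μ.real U with hu
  -- integrability of the indicator pieces
  have hintE : ∀ i ∈ s, Integrable ((E i).indicator (1 : Ω → ℝ)) μ := fun i hi =>
    (integrable_const (1 : ℝ)).indicator (hE i hi)
  have hintEE : ∀ i ∈ s, ∀ j ∈ s, Integrable ((E i ∩ E j).indicator (1 : Ω → ℝ)) μ := fun i hi j hj =>
    (integrable_const (1 : ℝ)).indicator ((hE i hi).inter (hE j hj))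
  have hintU : Integrable (U.indicator (1 : Ω → ℝ)) μ := (integrable_const (1 : ℝ)).indicator hUm
  -- the quadratic `Q(t) = S₂ - 2 t S₁ + t² u ≥ 0`
  have hQ : ∀ t : ℝ, 0 ≤ S₂ - 2 * t * S₁ + t ^ 2 * u := by
    intro t
    have hnn : 0 ≤ ∫ ω, (∑ i ∈ s, (E i).indicator (1 : Ω → ℝ) ω - t * U.indicator 1 ω) ^ 2 ∂μ :=
      integral_nonneg fun ω => sq_nonneg _
    have hexp : ∫ ω, (∑ i ∈ s, (E i).indicator (1 : Ω → ℝ) ω - t * U.indicator 1 ω) ^ 2 ∂μ =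
        S₂ - 2 * t * S₁ + t ^ 2 * u := by
      simp_rw [countSq_expand s E U hsub t]
      have h1 : Integrable (fun ω => ∑ i ∈ s, ∑ j ∈ s, (E i ∩ E j).indicator (1 : Ω → ℝ) ω) μ :=
        integrable_finsetSum _ fun i hi => integrable_finsetSum _ fun j hj => hintEE i hi j hj
      have h2 : Integrable (fun ω => 2 * t * ∑ i ∈ s, (E i).indicator (1 : Ω → ℝ) ω) μ :=
        (integrable_finsetSum _ fun i hi => hintE i hi).const_mul _
      have h3 : Integrable (fun ω => t ^ 2 * U.indicator (1 : Ω → ℝ) ω) μ := hintU.const_mul _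
      have h12 : Integrable (fun ω => ∑ i ∈ s, ∑ j ∈ s, (E i ∩ E j).indicator (1 : Ω → ℝ) ω
          - 2 * t * ∑ i ∈ s, (E i).indicator (1 : Ω → ℝ) ω) μ := h1.sub h2
      rw [integral_add h12 h3, integral_sub h1 h2, integral_const_mul, integral_const_mul,
        integral_finsetSum _ fun i hi => integrable_finsetSum _ fun j hj => hintEE i hi j hj,
        integral_finsetSum _ fun i hi => hintE i hi, integral_indicator_one hUm]
      have e2 : ∑ i ∈ s, ∫ ω, (E i).indicator (1 : Ω → ℝ) ω ∂μ = S₁ := by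
        rw [hS₁]
        exact Finset.sum_congr rfl fun i hi => integral_indicator_one (hE i hi)
      have e1 : ∑ i ∈ s, ∫ ω, ∑ j ∈ s, (E i ∩ E j).indicator (1 : Ω → ℝ) ω ∂μ = S₂ := by
        rw [hS₂]
        refine Finset.sum_congr rfl fun i hi => ?_
        rw [integral_finsetSum _ fun j hj => hintEE i hi j hj]
        exact Finset.sum_congr rfl fun j hj => integral_indicator_one ((hE i hi).inter (hE j hj))
      rw [e1, e2]
    rw [hexp] at hnn
    exact hnn
  -- conclude
  have hu0 : 0 ≤ u := measureReal_nonneg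
  rcases hu0.eq_or_lt with hu0' | hupos
  · -- `μ U = 0`: every `E i ⊆ U` has measure `0`, so `S₁ = 0`
    have hS10 : S₁ = 0 := by
      rw [hS₁]
      refine Finset.sum_eq_zero fun i hi => le_antisymm ?_ measureReal_nonneg
      calc μ.real (E i) ≤ μ.real U := measureReal_mono (hsub i hi) (measure_ne_top μ U)
        _ = 0 := hu0'.symm
    change S₁ ^ 2 ≤ u * S₂
    rw [hS10, ← hu0']
    simp
  · have h := hQ (S₁ / u)
    -- `0 ≤ S₂ - 2 (S₁/u) S₁ + (S₁/u)² u = S₂ - S₁²/u`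
    have h' : S₁ ^ 2 / u ≤ S₂ := by
      have e : S₂ - 2 * (S₁ / u) * S₁ + (S₁ / u) ^ 2 * u = S₂ - S₁ ^ 2 / u := by
        field_simp
        ring
      rw [e] at h
      linarith
    change S₁ ^ 2 ≤ u * S₂
    rw [div_le_iff₀ hupos] at h'
    linarith

/-- **Chung–Erdős, ratio form**: if `Σ_i Σ_j μ(E i ∩ E j) > 0` then
`μ(⋃ E i) ≥ (Σ μ(E i))² / Σ Σ μ(E i ∩ E j)`. [folklore] -/
theorem sq_sum_div_le_real_biUnion (μ : Measure Ω) [IsFiniteMeasure μ] (s : Finset ι) (E : ι → Set Ω)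
    (hE : ∀ i ∈ s, MeasurableSet (E i)) (hpos : 0 < ∑ i ∈ s, ∑ j ∈ s, μ.real (E i ∩ E j)) :
    (∑ i ∈ s, μ.real (E i)) ^ 2 / ∑ i ∈ s, ∑ j ∈ s, μ.real (E i ∩ E j) ≤ μ.real (⋃ i ∈ s, E i) := by
  rw [div_le_iff₀ hpos]
  exact sq_sum_real_le_real_biUnion_mul μ s E hE

/-- **Chung–Erdős with upper/lower bounds plugged in**: if `a ≤ μ(E i)` for all `i ∈ s` (`a ≥ 0`) and
`Σ_i Σ_j μ(E i ∩ E j) ≤ D` with `D > 0`, then `μ(⋃ E i) ≥ (|s| a)² / D`. [folklore] -/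
theorem real_biUnion_ge_of_bounds (μ : Measure Ω) [IsFiniteMeasure μ] (s : Finset ι) (E : ι → Set Ω)
    (hE : ∀ i ∈ s, MeasurableSet (E i)) {a D : ℝ} (ha : 0 ≤ a) (haE : ∀ i ∈ s, a ≤ μ.real (E i))
    (hD : ∑ i ∈ s, ∑ j ∈ s, μ.real (E i ∩ E j) ≤ D) (hD0 : 0 < D) :
    (s.card * a) ^ 2 / D ≤ μ.real (⋃ i ∈ s, E i) := by
  have h := sq_sum_real_le_real_biUnion_mul μ s E hE
  have hS : (s.card : ℝ) * a ≤ ∑ i ∈ s, μ.real (E i) := by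
    rw [← nsmul_eq_mul, ← Finset.sum_const]
    exact Finset.sum_le_sum haE
  have hS0 : 0 ≤ (s.card : ℝ) * a := by positivity
  have h1 : ((s.card : ℝ) * a) ^ 2 ≤ (∑ i ∈ s, μ.real (E i)) ^ 2 := pow_le_pow_left₀ hS0 hS 2
  have hU0 : 0 ≤ μ.real (⋃ i ∈ s, E i) := measureReal_nonneg
  rw [div_le_iff₀ hD0]
  calc ((s.card : ℝ) * a) ^ 2 ≤ (∑ i ∈ s, μ.real (E i)) ^ 2 := h1
    _ ≤ μ.real (⋃ i ∈ s, E i) * ∑ i ∈ s, ∑ j ∈ s, μ.real (E i ∩ E j) := h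
    _ ≤ μ.real (⋃ i ∈ s, E i) * D := mul_le_mul_of_nonneg_left hD hU0

end Ray

end Summit.CriticalPhenomena.PercolationContinuityZ3.Theorems.TransplantSharpness
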